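import Literature.MeasureTheory.Lebesgue.AxisSwapQuadraticSubstitution
import Literature.MathematicalPhysics.KineticTheory.HardSphereEntranceProofs
import Mathlib.Analysis.SpecialFunctions.ImproperIntegrals
import HarnessLib

/-!
# The exchange symmetry of the three-dimensional hard-sphere gain term, I: preparations

For the unit sphere `S² ⊆ ℝ³ = EuclideanSpace ℝ (Fin 3)` with its surface measure
`σ = volume.toSphere` (`KineticTheory.sphereMeasure`) and the axis `e = e₂`, we prove

`∫_{S²} (ω·e)₊ G((ω·e) ω) dσ(ω) = ∫_{S²} (ω·e)₊ G(e - (ω·e) ω) dσ(ω)`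
(`lintegral_sphere_gain_exchange_axis`)

for every measurable `G ≥ 0` on `ℝ³` (the identity itself is in `HardSphereGainExchangeAxis.lean`;
this file contains the preparations). With `V = |V| e` the two arguments are (up to the factor
`|V|`) the velocity transfers `(V·ω) ω` and `V - (V·ω) ω` of a hard-sphere collision with relative
velocity `V`; the identity says that both are distributed alike under `(V·ω)₊ dω`, which is
special to dimension `3` (isotropy of the hard-sphere cross-section in the `σ`-representation).
Proof: both sides are recovered, through polar coordinates
(`KineticTheory.lintegral_eq_lintegral_sphereMeasure_polar`) and the radial profile
`ρ(r) = 1_{r > 1} r⁻⁴`, from one volume integral `∫ H` over the upper half-space, computed once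
directly and once after the quadratic substitution `Q(x) = |P x|² e - (x·e) P x` (`P` the
projection on `e⊥`; `Literature.MeasureTheory.Lebesgue.lintegral_halfSpace_eq_lintegral_quadraticSwap`),
which maps `r ω` to `r² (e - (ω·e) ω)` and has Jacobian `2 (x·e) |P x|²`.

This file: the substitution transported to `EuclideanSpace ℝ (Fin 3)`
(`lintegral_halfSpace_eq_quadraticSwap_euclidean`), the two radial integrals
`∫_1^∞ r⁻² dr = 1`, `∫_{r² s > 1} r⁵ (r² s)⁻⁴ dr = s⁻³/2` (`lintegral_radial_weight`,
`lintegral_radial_weight_sq`), and the fact that points are null for the surface measure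
(`sphereMeasure_singleton`). No new definitions are introduced.
-/

open MeasureTheory Metric Set Filter Real
open scoped ENNReal InnerProductSpace Pointwise

namespace Literature.MathematicalPhysics.KineticTheory

noncomputable section

/-! ### Transport of the quadratic substitution to `EuclideanSpace ℝ (Fin 3)` -/

/-- `⟪x, e₂⟫ = x₂`. [folklore] -/
theorem inner_single_two (x : EuclideanSpace ℝ (Fin 3)) :
    ⟪x, EuclideanSpace.single 2 (1 : ℝ)⟫_ℝ = x 2 := by
  simp [EuclideanSpace.inner_single_right]

/-- Coordinates of `x - (x·e₂) e₂`. [folklore] -/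
theorem euclidean_sub_inner_single (x : EuclideanSpace ℝ (Fin 3)) :
    x - ⟪x, EuclideanSpace.single 2 (1 : ℝ)⟫_ℝ • EuclideanSpace.single 2 (1 : ℝ) =
      WithLp.toLp 2 ![x 0, x 1, 0] := by
  ext i
  fin_cases i <;> simp [EuclideanSpace.inner_single_right]

/-- `|x - (x·e₂) e₂|² = x₀² + x₁²`. [folklore] -/
theorem norm_sq_sub_inner_single (x : EuclideanSpace ℝ (Fin 3)) :
    ‖x - ⟪x, EuclideanSpace.single 2 (1 : ℝ)⟫_ℝ • EuclideanSpace.single 2 (1 : ℝ)‖ ^ 2 =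
      x 0 ^ 2 + x 1 ^ 2 := by
  rw [euclidean_sub_inner_single, EuclideanSpace.real_norm_sq_eq, Fin.sum_univ_three]
  simp

/-- The quadratic map `Q(x) = |P x|² e - (x·e) P x` in coordinates:
`Q(x) = (-x₂ x₀, -x₂ x₁, x₀² + x₁²)`. [folklore] -/
theorem quadraticSwap_euclidean (x : EuclideanSpace ℝ (Fin 3)) :
    ‖x - ⟪x, EuclideanSpace.single 2 (1 : ℝ)⟫_ℝ • EuclideanSpace.single 2 (1 : ℝ)‖ ^ 2 •
        EuclideanSpace.single 2 (1 : ℝ) -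
      ⟪x, EuclideanSpace.single 2 (1 : ℝ)⟫_ℝ •
        (x - ⟪x, EuclideanSpace.single 2 (1 : ℝ)⟫_ℝ • EuclideanSpace.single 2 (1 : ℝ)) =
      WithLp.toLp 2 ![-(x 2 * x 0), -(x 2 * x 1), x 0 ^ 2 + x 1 ^ 2] := by
  rw [norm_sq_sub_inner_single, euclidean_sub_inner_single, inner_single_two]
  ext i
  fin_cases i <;> simp

/-- The quadratic map `Q` is continuous. [folklore] -/
theorem continuous_quadraticSwap_euclidean :
    Continuous fun x : EuclideanSpace ℝ (Fin 3) =>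
      ‖x - ⟪x, EuclideanSpace.single 2 (1 : ℝ)⟫_ℝ • EuclideanSpace.single 2 (1 : ℝ)‖ ^ 2 •
          EuclideanSpace.single 2 (1 : ℝ) -
        ⟪x, EuclideanSpace.single 2 (1 : ℝ)⟫_ℝ •
          (x - ⟪x, EuclideanSpace.single 2 (1 : ℝ)⟫_ℝ • EuclideanSpace.single 2 (1 : ℝ)) := by
  fun_prop

/-- The open upper half-space `{x·e₂ > 0}` is measurable. [folklore] -/
theorem measurableSet_halfSpace_single_two :
    MeasurableSet {y : EuclideanSpace ℝ (Fin 3) | 0 < ⟪y, EuclideanSpace.single 2 (1 : ℝ)⟫_ℝ} :=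
  measurableSet_lt measurable_const (continuous_id.inner continuous_const).measurable

/-- **The quadratic substitution on the upper half-space of `EuclideanSpace ℝ (Fin 3)`**
(transport of `lintegral_halfSpace_eq_lintegral_quadraticSwap` along the measure-preserving
`WithLp.toLp`): for measurable `Φ ≥ 0`, `e = e₂` and `P x = x - (x·e) e`,
`∫_{x·e > 0} Φ = ∫_{x·e > 0} 2 (x·e) |P x|² Φ(|P x|² e - (x·e) P x)`. [folklore] -/
theorem lintegral_halfSpace_eq_quadraticSwap_euclidean {Φ : EuclideanSpace ℝ (Fin 3) → ℝ≥0∞}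
    (hΦ : Measurable Φ) :
    ∫⁻ y, {y : EuclideanSpace ℝ (Fin 3) | 0 < ⟪y, EuclideanSpace.single 2 (1 : ℝ)⟫_ℝ}.indicator Φ y =
      ∫⁻ x, {x : EuclideanSpace ℝ (Fin 3) | 0 < ⟪x, EuclideanSpace.single 2 (1 : ℝ)⟫_ℝ}.indicator
        (fun x => ENNReal.ofReal (2 * ⟪x, EuclideanSpace.single 2 (1 : ℝ)⟫_ℝ *
            ‖x - ⟪x, EuclideanSpace.single 2 (1 : ℝ)⟫_ℝ • EuclideanSpace.single 2 (1 : ℝ)‖ ^ 2) *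
          Φ (‖x - ⟪x, EuclideanSpace.single 2 (1 : ℝ)⟫_ℝ • EuclideanSpace.single 2 (1 : ℝ)‖ ^ 2 •
              EuclideanSpace.single 2 (1 : ℝ) -
            ⟪x, EuclideanSpace.single 2 (1 : ℝ)⟫_ℝ •
              (x - ⟪x, EuclideanSpace.single 2 (1 : ℝ)⟫_ℝ • EuclideanSpace.single 2 (1 : ℝ)))) x := by
  have hmp := PiLp.volume_preserving_toLp (ι := Fin 3)
  have hS := measurableSet_halfSpace_single_two
  have hcont : Continuous fun x : EuclideanSpace ℝ (Fin 3) =>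
      2 * ⟪x, EuclideanSpace.single 2 (1 : ℝ)⟫_ℝ *
        ‖x - ⟪x, EuclideanSpace.single 2 (1 : ℝ)⟫_ℝ • EuclideanSpace.single 2 (1 : ℝ)‖ ^ 2 := by
    fun_prop
  have hR : Measurable fun x : EuclideanSpace ℝ (Fin 3) =>
      ENNReal.ofReal (2 * ⟪x, EuclideanSpace.single 2 (1 : ℝ)⟫_ℝ *
          ‖x - ⟪x, EuclideanSpace.single 2 (1 : ℝ)⟫_ℝ • EuclideanSpace.single 2 (1 : ℝ)‖ ^ 2) *
        Φ (‖x - ⟪x, EuclideanSpace.single 2 (1 : ℝ)⟫_ℝ • EuclideanSpace.single 2 (1 : ℝ)‖ ^ 2 •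
            EuclideanSpace.single 2 (1 : ℝ) -
          ⟪x, EuclideanSpace.single 2 (1 : ℝ)⟫_ℝ •
            (x - ⟪x, EuclideanSpace.single 2 (1 : ℝ)⟫_ℝ • EuclideanSpace.single 2 (1 : ℝ))) :=
    hcont.measurable.ennreal_ofReal.mul (hΦ.comp continuous_quadraticSwap_euclidean.measurable)
  rw [← hmp.lintegral_comp (hΦ.indicator hS), ← hmp.lintegral_comp (hR.indicator hS)]
  -- the pulled-back sets and integrands
  have hpre : (WithLp.toLp 2) ⁻¹'
      {y : EuclideanSpace ℝ (Fin 3) | 0 < ⟪y, EuclideanSpace.single 2 (1 : ℝ)⟫_ℝ} =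
      {v : Fin 3 → ℝ | 0 < v 2} := by
    ext v
    simp [inner_single_two]
  have hmeas : MeasurableSet {v : Fin 3 → ℝ | 0 < v 2} :=
    measurableSet_lt measurable_const (measurable_pi_apply 2)
  have h1 : ∀ v : Fin 3 → ℝ,
      {y : EuclideanSpace ℝ (Fin 3) | 0 < ⟪y, EuclideanSpace.single 2 (1 : ℝ)⟫_ℝ}.indicator Φ
        (WithLp.toLp 2 v) = {v : Fin 3 → ℝ | 0 < v 2}.indicator (fun v => Φ (WithLp.toLp 2 v)) v := by
    intro v
    rw [← hpre, ← indicator_comp_right]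
    rfl
  have h2 : ∀ v : Fin 3 → ℝ,
      {x : EuclideanSpace ℝ (Fin 3) | 0 < ⟪x, EuclideanSpace.single 2 (1 : ℝ)⟫_ℝ}.indicator
        (fun x => ENNReal.ofReal (2 * ⟪x, EuclideanSpace.single 2 (1 : ℝ)⟫_ℝ *
            ‖x - ⟪x, EuclideanSpace.single 2 (1 : ℝ)⟫_ℝ • EuclideanSpace.single 2 (1 : ℝ)‖ ^ 2) *
          Φ (‖x - ⟪x, EuclideanSpace.single 2 (1 : ℝ)⟫_ℝ • EuclideanSpace.single 2 (1 : ℝ)‖ ^ 2 •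
              EuclideanSpace.single 2 (1 : ℝ) -
            ⟪x, EuclideanSpace.single 2 (1 : ℝ)⟫_ℝ •
              (x - ⟪x, EuclideanSpace.single 2 (1 : ℝ)⟫_ℝ • EuclideanSpace.single 2 (1 : ℝ))))
        (WithLp.toLp 2 v) =
      {v : Fin 3 → ℝ | 0 < v 2}.indicator (fun v => ENNReal.ofReal (2 * v 2 * (v 0 ^ 2 + v 1 ^ 2)) *
        Φ (WithLp.toLp 2 ![-(v 2 * v 0), -(v 2 * v 1), v 0 ^ 2 + v 1 ^ 2])) v := by
    intro v
    rw [← hpre, ← indicator_comp_right]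
    congr 1
    funext u
    simp only [Function.comp_apply]
    rw [quadraticSwap_euclidean, norm_sq_sub_inner_single, inner_single_two]
  simp_rw [h1, h2]
  rw [lintegral_indicator hmeas, lintegral_indicator hmeas]
  exact Literature.MeasureTheory.Lebesgue.lintegral_halfSpace_eq_lintegral_quadraticSwap
    (fun v => Φ (WithLp.toLp 2 v))

/-! ### Points are null for the surface measure -/

section Singleton

variable {E : Type*} [NormedAddCommGroup E] [InnerProductSpace ℝ E] [FiniteDimensional ℝ E]
  [MeasurableSpace E] [BorelSpace E]

/-- In dimension `≥ 2` a single point of the unit sphere has surface measure zero (the cone over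
it lies in a line, a proper subspace). [folklore] -/
theorem sphereMeasure_singleton (hE : 2 ≤ Module.finrank ℝ E) (ω₀ : sphere (0 : E) 1) :
    sphereMeasure ({ω₀} : Set (sphere (0 : E) 1)) = 0 := by
  unfold sphereMeasure
  rw [Measure.toSphere_apply' _ (measurableSet_singleton ω₀)]
  have hsub : Ioo (0 : ℝ) 1 • (((↑) : sphere (0 : E) 1 → E) '' {ω₀}) ⊆
      (Submodule.span ℝ {(ω₀ : E)} : Set E) := by
    rintro x ⟨t, -, y, hy, rfl⟩
    rw [image_singleton, mem_singleton_iff] at hy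
    rw [hy]
    exact Submodule.smul_mem _ _ (Submodule.subset_span rfl)
  have hne : Submodule.span ℝ {(ω₀ : E)} ≠ ⊤ := by
    intro htop
    have h1 : Module.finrank ℝ (Submodule.span ℝ ({(ω₀ : E)} : Set E)) ≤ 1 := by
      simpa using finrank_span_le_card ({(ω₀ : E)} : Set E)
    rw [htop, finrank_top] at h1
    omega
  rw [measure_mono_null hsub (Measure.addHaar_submodule volume _ hne), mul_zero]

end Singleton

/-! ### The two radial integrals -/

/-- `∫_0^∞ r² ρ(r) dr = 1` for the radial profile `ρ(r) = 1_{r > 1} r⁻⁴`. [folklore] -/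
theorem lintegral_radial_weight :
    ∫⁻ r in Ioi (0 : ℝ), ENNReal.ofReal (r ^ 2) *
      {t : ℝ | 1 < t}.indicator (fun t => ENNReal.ofReal ((t ^ 4)⁻¹)) r = 1 := by
  have hpt : ∀ r ∈ Ioi (0 : ℝ), ENNReal.ofReal (r ^ 2) *
      {t : ℝ | 1 < t}.indicator (fun t => ENNReal.ofReal ((t ^ 4)⁻¹)) r =
      (Ioi (1 : ℝ)).indicator (fun t => ENNReal.ofReal (t ^ (-2 : ℝ))) r := by
    intro r hr
    have hr0 : 0 < r := hr
    by_cases h1 : 1 < r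
    · rw [indicator_of_mem (show r ∈ {t : ℝ | 1 < t} from h1), indicator_of_mem (show r ∈ Ioi (1:ℝ) from h1),
        ← ENNReal.ofReal_mul (by positivity)]
      congr 1
      rw [Real.rpow_neg hr0.le, show (2 : ℝ) = ((2 : ℕ) : ℝ) by norm_num, Real.rpow_natCast]
      field_simp
    · rw [indicator_of_notMem (show r ∉ {t : ℝ | 1 < t} from h1),
        indicator_of_notMem (show r ∉ Ioi (1 : ℝ) from h1), mul_zero]
  rw [setLIntegral_congr_fun measurableSet_Ioi hpt, setLIntegral_indicator measurableSet_Ioi,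
    Ioi_inter_Ioi, show max (1 : ℝ) 0 = 1 by norm_num]
  have hint := integrableOn_Ioi_rpow_of_lt (show (-2 : ℝ) < -1 by norm_num) one_pos
  rw [← ofReal_integral_eq_lintegral_ofReal hint
    (ae_restrict_of_forall_mem measurableSet_Ioi fun r hr =>
      Real.rpow_nonneg (zero_le_one.trans (le_of_lt hr)) _),
    integral_Ioi_rpow_of_lt (show (-2 : ℝ) < -1 by norm_num) one_pos]
  norm_num

/-- `∫_0^∞ r⁵ ρ(r² s) dr = s⁻³ / 2` for `s > 0` and `ρ(r) = 1_{r > 1} r⁻⁴` (the substitution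
`t = r² s` of the quadratic map on radii). [folklore] -/
theorem lintegral_radial_weight_sq {s : ℝ} (hs : 0 < s) :
    ∫⁻ r in Ioi (0 : ℝ), ENNReal.ofReal (r ^ 5) *
      {t : ℝ | 1 < t}.indicator (fun t => ENNReal.ofReal ((t ^ 4)⁻¹)) (r ^ 2 * s) =
      ENNReal.ofReal ((s ^ 3)⁻¹ / 2) := by
  set c₀ : ℝ := (Real.sqrt s)⁻¹ with hc₀
  have hsq : 0 < Real.sqrt s := Real.sqrt_pos.2 hs
  have hc₀0 : 0 < c₀ := inv_pos.2 hsq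
  have hc₀2 : c₀ ^ 2 = s⁻¹ := by rw [hc₀, inv_pow, Real.sq_sqrt hs.le]
  -- `r² s > 1 ↔ r > c₀` for `r > 0`
  have hiff : ∀ r : ℝ, 0 < r → (1 < r ^ 2 * s ↔ c₀ < r) := by
    intro r hr
    rw [← sq_lt_sq₀ hc₀0.le hr.le, hc₀2, inv_lt_iff_one_lt_mul₀ hs, mul_comm]
  have hpt : ∀ r ∈ Ioi (0 : ℝ), ENNReal.ofReal (r ^ 5) *
      {t : ℝ | 1 < t}.indicator (fun t => ENNReal.ofReal ((t ^ 4)⁻¹)) (r ^ 2 * s) =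
      (Ioi c₀).indicator (fun t => ENNReal.ofReal ((s ^ 4)⁻¹) * ENNReal.ofReal (t ^ (-3 : ℝ))) r := by
    intro r hr
    have hr0 : 0 < r := hr
    by_cases h1 : c₀ < r
    · have h1' : 1 < r ^ 2 * s := (hiff r hr0).2 h1
      rw [indicator_of_mem (show r ^ 2 * s ∈ {t : ℝ | 1 < t} from h1'),
        indicator_of_mem (show r ∈ Ioi c₀ from h1), ← ENNReal.ofReal_mul (by positivity),
        ← ENNReal.ofReal_mul (by positivity)]
      congr 1
      rw [Real.rpow_neg hr0.le, show (3 : ℝ) = ((3 : ℕ) : ℝ) by norm_num, Real.rpow_natCast]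
      field_simp
    · have h1' : ¬ 1 < r ^ 2 * s := fun h => h1 ((hiff r hr0).1 h)
      rw [indicator_of_notMem (show r ^ 2 * s ∉ {t : ℝ | 1 < t} from h1'),
        indicator_of_notMem (show r ∉ Ioi c₀ from h1), mul_zero]
  rw [setLIntegral_congr_fun measurableSet_Ioi hpt, setLIntegral_indicator measurableSet_Ioi,
    Ioi_inter_Ioi, max_eq_left hc₀0.le,
    lintegral_const_mul _ ((measurable_id'.pow_const (-3 : ℝ)).ennreal_ofReal)]
  have hint := integrableOn_Ioi_rpow_of_lt (show (-3 : ℝ) < -1 by norm_num) hc₀0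
  rw [← ofReal_integral_eq_lintegral_ofReal hint
    (ae_restrict_of_forall_mem measurableSet_Ioi fun r hr =>
      Real.rpow_nonneg (hc₀0.le.trans (le_of_lt hr)) _),
    integral_Ioi_rpow_of_lt (show (-3 : ℝ) < -1 by norm_num) hc₀0,
    ← ENNReal.ofReal_mul (by positivity)]
  congr 1
  have h2 : c₀ ^ ((-3 : ℝ) + 1) = s := by
    rw [show (-3 : ℝ) + 1 = -2 by norm_num, Real.rpow_neg hc₀0.le,
      show (2 : ℝ) = ((2 : ℕ) : ℝ) by norm_num, Real.rpow_natCast, hc₀2, inv_inv]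
  rw [h2]
  field_simp
  norm_num

end

end Literature.MathematicalPhysics.KineticTheory
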